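import Summits.QuantumFields.BalabanUV.Beta.FP.KernelStepDressing
import Summits.QuantumFields.BalabanUV.Beta.FP.PeriodisedBorderTables
import Summits.QuantumFields.BalabanUV.Beta.NVertexParities
import Literature.MathematicalPhysics.QuantumFieldTheory.Balaban1983to89.Beta.HessianTelescopingKKT

/-!
# `BalabanUV.Beta.FP.TowerFFamilyParities` — road «FP», binder row D1, ROUTE T (β1), (H5-F) box side, part 1: **THE TWO FIRST-ORDER PARITY LETTERS `hVFm hVFt` OF THE
# DRESSED F-FAMILY, BY NAME** — the periodised σ′-scaled `Lc⁴ • dressV (Lc^(n+1)) Lc (wStep Lc (n+1)) (VN ctr Pn n)` has NO entries on two multiplier indices and reads a field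
# index against a multiplier index the same both ways (v10 `StepRecursionFeedNestedNamedI` L.246–247), because an2's `VN` does (`NVertexParities.VN_inr_inr`, `VN_inr ∕ VN_inl_inr` +
# `VbN_symm`) and the dressing superposes `VN c t` with scalar weights

WHY (located).  road g58 STAGED-4 l.68991 ∕ A-2 (c): after `TowerFChartLetters` (p734790), `KernelStepDressing{,HessKer}` and `TowerFTransportRow` the END's (H5-F) group at the record
keeps, on the box side, the winding letter, FOUR PARITIES and four door-jet identifications.  The two FIRST-ORDER parities are pointwise facts about `VN`'s fibre blocks carried through a
scalar superposition; this file discharges them (END 43 → 41 by kernel).  The second-order pair `hWFm hWFt` needs the WOUND per-box family `𝒲bF` (next part).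

WHAT ([folklore]; no `def`, no `def … : Prop`, nothing cited, 0 sorry).
* §1 pointwise: `VN_inl_inr_transpose` (`VN c t x z (inl α) (inr m) = VN c t z x (inr m) (inl α)`), `dressV_apply_inr_inr_VN` (= 0), the `(inl,inr)`∕`(inr,inl)` entries of
  `dressV … (VN …)` are `cVH •` those of the dressed BORDER vertex (`dressV_inl_inr_VN ∕ dressV_inr_inl_VN`), which is fully transpose-symmetric (`dressV_VbN_symm`).
* §2 at the END's family `K := scaleK σ′ σ′ (Lc⁴ • dressV …)`: `FRec_inr_inr` (= 0), `FRec_inl_inr_eq_transpose`.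
* §3 **`hVFm_rec`**, **`hVFt_rec`** — v10's binder texts (L.246–247) under σ = {`(𝒱F (n+1))` ↦ the family above, `((fF n) B)` ↦ any index map landing in multiplier fibres}
  (generic `f` with `∀ a, ∃ m, (f a).2 = inr m` — (H3)'s `hmF_rec` at the END), by `perF_dper_apply_congr_entry`-type fibre-entrywise reading and road `PeriodisedBorderTables.perZ_dper_symm`.
WHAT THIS IS NOT: not `hWFm hWFt hWFw hHF₁ hQF₁ hHF₂ hQF₂`; nothing of Bałaban's asserted, valued or discharged; 0 estimates; 0∕4 row-D1 binders; NOT (C1), NOT D1, NEVER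
«G-an2-4 closed», NOT BetaPertH, NOT continuum, NOT Clay.
HONEST DEPENDENCY (page 1, mandatory): continuum YM on T⁴ ⇐ BetaPertH ∧ nine spine estimates (0/9 proved); BetaPertH ⇐ (D1) ∧ (D4) ∧ CAP+tail;
G-an2-4 gates asym, D1 and NE2/3/4.  HONEST FRAMING (cell contract, verbatim): «discharging `BetaPertH` makes Bałaban's UV stability UNCONDITIONAL —
a real constructive-QFT result; it is NOT the continuum limit and NOT the Clay problem.»  ABSOLUTE RULE (cell charter, verbatim): «No internally-minted
statement may enter as a cited fact. Every hypothesis is either kernel-proved in this package or a verbatim quotation of a PUBLISHED theorem with page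
reference. The manuscript(s) under audit are NOT citable for their own disputed steps — they are the thing under adjudication; programme-internal
(2001/route/tribunal) claims are never citable.»  Road «FP» OWNER, b2b-balaban-beta-d1-p3 gen 58, 2026-08-29.  No existing file touched.
-/

noncomputable section

open scoped BigOperators

namespace Summit.QuantumFields.BalabanUV.Beta.FP.TowerFFamilyParities

open Finset
open Literature.MathematicalPhysics.QuantumFieldTheory
open Literature.MathematicalPhysics.QuantumFieldTheory.Balaban1983to89
open Literature.MathematicalPhysics.QuantumFieldTheory.Balaban1983to89.Beta
open B6Lemma24Torus (pbox)
open ExpKernelCalculus (Site MKer)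
open DressedMomentNormalisation (EKer)
open HessKerRate (scaleK scaleK_apply)
open HessianTelescopingKKT (wStep)
open OneStepResolventKernel (Fib)
open OneStepKernelFamily (vertexOfK)
open InterLevelTransport (cwsum_apply)
open Summit.QuantumFields.BalabanUV.Beta.CompositeOneShotJets (compV)
open Summit.QuantumFields.BalabanUV.Beta.CompositeOneShotJetData (Roots Pins AN VN)
open Summit.QuantumFields.BalabanUV.Beta.NVertexParities (VN_inr VN_inl_inr VN_inr_inr VbN_symm)
open Summit.QuantumFields.BalabanUV.Beta.FP.KernelPeriodisationFib (Idx perF perZ perF_apply perZ_apply)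
open Summit.QuantumFields.BalabanUV.Beta.FP.KernelPeriodisationFibLoc (dper dper_apply)
open Summit.QuantumFields.BalabanUV.Beta.FP.PeriodisedBorderTables (perZ_dper_symm)
open Summit.QuantumFields.BalabanUV.Beta.FP.KernelStepDressing (dressV dressV_apply)

variable {Lc : ℕ} [NeZero Lc] (R : Roots Lc) (P : Pins)

/-! ## §1 Pointwise fibre blocks of the dressed N-vertex -/

section Pointwise

/-- [folklore] **THE N-VERTEX's FIELD–MULTIPLIER ENTRY IS THE TRANSPOSED MULTIPLIER–FIELD ENTRY** (`VN_inl_inr ∕ VN_inr`: both are `cVH •` the border vertex's, which is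
transpose-symmetric — `VbN_symm`). -/
theorem VN_inl_inr_transpose (j : ℕ) (c : Fin (3 + 1)) (t x z : Site (3 + 1)) (α m : Fin (3 + 1)) :
    VN R P j c t x z (Sum.inl α) (Sum.inr m) = VN R P j c t z x (Sum.inr m) (Sum.inl α) := by
  rw [VN_inl_inr, VN_inr, VbN_symm]

variable (N L : ℕ) [NeZero N] (w : EKer (3 + 1))

/-- [folklore] The dressed family's entries are determined fibre-entrywise by the undressed family's. -/
theorem dressV_apply_congr {V V' : Fin (3 + 1) → Site (3 + 1) → MKer (3 + 1) (Fib 3)} {a b : Fib 3}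
    (h : ∀ c t x z, V c t x z a b = V' c t x z a b) (μ : Fin (3 + 1)) (y x z : Site (3 + 1)) :
    dressV N L w V μ y x z a b = dressV N L w V' μ y x z a b := by
  rw [dressV_apply, dressV_apply]
  simp only [h]

/-- [folklore] **NO MULTIPLIER–MULTIPLIER ENTRIES** survive the dressing of `VN`. -/
theorem dressV_apply_inr_inr_VN (j : ℕ) (μ : Fin (3 + 1)) (y x z : Site (3 + 1)) (m m' : Fin (3 + 1)) :
    dressV N L w (VN R P j) μ y x z (Sum.inr m) (Sum.inr m') = 0 := by
  rw [dressV_apply]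
  simp only [VN_inr_inr, mul_zero, tsum_zero, Finset.sum_const_zero]

/-- [folklore] **THE DRESSED FAMILY INHERITS THE FIELD–MULTIPLIER TRANSPOSE SYMMETRY** of `VN`. -/
theorem dressV_inl_inr_transpose_VN (j : ℕ) (μ : Fin (3 + 1)) (y x z : Site (3 + 1)) (α m : Fin (3 + 1)) :
    dressV N L w (VN R P j) μ y x z (Sum.inl α) (Sum.inr m) = dressV N L w (VN R P j) μ y z x (Sum.inr m) (Sum.inl α) := by
  rw [dressV_apply, dressV_apply]
  simp only [VN_inl_inr_transpose]

end Pointwise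

/-! ## §2 The END's first-order F-family `scaleK σ′ σ′ (Lc⁴ • dressV …)` -/

section Family

variable (uF : ℕ → ℝ) (n : ℕ)

/-- [folklore] the END's dressed first-order family has no multiplier–multiplier entries. -/
theorem FRec_inr_inr (μ : Fin (3 + 1)) (y x z : Site (3 + 1)) (m m' : Fin (3 + 1)) :
    scaleK (Sum.elim (fun _ : Fin (3 + 1) => (1 : ℝ)) (fun _ : Fin (3 + 1) => (uF n))) (Sum.elim (fun _ : Fin (3 + 1) => (1 : ℝ)) (fun _ : Fin (3 + 1) => (uF n)))
        ((Lc : ℝ) ^ 4 • dressV (Lc ^ (n + 1)) Lc (wStep Lc (n + 1)) (VN (Roots.ctr Lc) P n) μ y) x z (Sum.inr m) (Sum.inr m') = 0 := by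
  rw [scaleK_apply]
  simp only [Pi.smul_apply, smul_eq_mul, dressV_apply_inr_inr_VN, mul_zero, zero_mul]

/-- [folklore] the END's dressed first-order family reads `(inl α, inr m)` at `(x, z)` as `(inr m, inl α)` at `(z, x)` (equal units on both legs). -/
theorem FRec_inl_inr_eq_transpose (μ : Fin (3 + 1)) (y x z : Site (3 + 1)) (α m : Fin (3 + 1)) :
    scaleK (Sum.elim (fun _ : Fin (3 + 1) => (1 : ℝ)) (fun _ : Fin (3 + 1) => (uF n))) (Sum.elim (fun _ : Fin (3 + 1) => (1 : ℝ)) (fun _ : Fin (3 + 1) => (uF n)))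
        ((Lc : ℝ) ^ 4 • dressV (Lc ^ (n + 1)) Lc (wStep Lc (n + 1)) (VN (Roots.ctr Lc) P n) μ y) x z (Sum.inl α) (Sum.inr m)
      = scaleK (Sum.elim (fun _ : Fin (3 + 1) => (1 : ℝ)) (fun _ : Fin (3 + 1) => (uF n))) (Sum.elim (fun _ : Fin (3 + 1) => (1 : ℝ)) (fun _ : Fin (3 + 1) => (uF n)))
        ((Lc : ℝ) ^ 4 • dressV (Lc ^ (n + 1)) Lc (wStep Lc (n + 1)) (VN (Roots.ctr Lc) P n) μ y) z x (Sum.inr m) (Sum.inl α) := by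
  rw [scaleK_apply, scaleK_apply]
  simp only [Pi.smul_apply, smul_eq_mul, Sum.elim_inl, Sum.elim_inr, dressV_inl_inr_transpose_VN]
  ring

end Family

/-! ## §3 THE TWO LETTERS, in v10's binder texts under σ = {`(𝒱F (n+1))` ↦ the dressed family}, for any index map landing in multiplier fibres -/

section Record

variable (Lc) (Pn : Pins) (uF : ℕ → ℝ)

/-- [folklore] **`hVFm` AT THE RECORD** — v10 `StepRecursionFeedNestedNamedI.d1Tel_JcComp_ctr_namedI`'s binder `hVFm` (L.246) with `(𝒱F (n + 1))` ↦ the σ′-scaled `Lc⁴ •` dressed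
N-vertex and the index map `(fF n) B` generic (`f`, landing in multiplier fibres — (H3)'s `hmF_rec` at the END): the periodised family VANISHES on two such indices. -/
theorem hVFm_rec {M : Fin (3 + 1) → ℕ} [∀ i, NeZero (M i)] {ι : Type*} (f : ι → Idx M (Fib 3)) (hf : ∀ a : ι, ∃ m : Fin (3 + 1), (f a).2 = Sum.inr m)
    (n : ℕ) (μ : Fin (3 + 1)) (y : Fin (3 + 1) → ℤ) (a a' : ι) :
    (perF M (dper M ((fun μ y => scaleK (Sum.elim (fun _ : Fin (3 + 1) => (1 : ℝ)) (fun _ : Fin (3 + 1) => (uF n))) (Sum.elim (fun _ : Fin (3 + 1) => (1 : ℝ)) (fun _ : Fin (3 + 1) => (uF n))) ((Lc : ℝ) ^ 4 • dressV (Lc ^ (n + 1)) Lc (wStep Lc (n + 1)) (VN (Roots.ctr Lc) Pn n) μ y)) μ y))) (f a) (f a') = 0 := by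
  obtain ⟨m, hm⟩ := hf a
  obtain ⟨m', hm'⟩ := hf a'
  have ha : f a = ((f a).1, Sum.inr m) := Prod.ext rfl hm
  have ha' : f a' = ((f a').1, Sum.inr m') := Prod.ext rfl hm'
  rw [ha, ha', perF_apply]
  simp only [perZ_apply, dper_apply, FRec_inr_inr, tsum_zero]

/-- [folklore] **`hVFt` AT THE RECORD** — v10's binder `hVFt` (L.247) under the same σ: a field index against an index in a multiplier fibre reads the same both ways
(fibre-entrywise the `(inl α, inr m)` entries are the transposed `(inr m, inl α)` ones, §2, and `perZ ∘ dper` transports a pointwise transpose symmetry — road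
`PeriodisedBorderTables.perZ_dper_symm`'s re-indexing, here for the two blocks that matter). -/
theorem hVFt_rec {M : Fin (3 + 1) → ℕ} [∀ i, NeZero (M i)] {ι : Type*} (f : ι → Idx M (Fib 3)) (hf : ∀ a : ι, ∃ m : Fin (3 + 1), (f a).2 = Sum.inr m)
    (n : ℕ) (μ : Fin (3 + 1)) (y : Fin (3 + 1) → ℤ) (b : ↥(pbox M) × Fin (3 + 1)) (a : ι) :
    (perF M (dper M ((fun μ y => scaleK (Sum.elim (fun _ : Fin (3 + 1) => (1 : ℝ)) (fun _ : Fin (3 + 1) => (uF n))) (Sum.elim (fun _ : Fin (3 + 1) => (1 : ℝ)) (fun _ : Fin (3 + 1) => (uF n))) ((Lc : ℝ) ^ 4 • dressV (Lc ^ (n + 1)) Lc (wStep Lc (n + 1)) (VN (Roots.ctr Lc) Pn n) μ y)) μ y))) (b.1, Sum.inl b.2) (f a)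
      = (perF M (dper M ((fun μ y => scaleK (Sum.elim (fun _ : Fin (3 + 1) => (1 : ℝ)) (fun _ : Fin (3 + 1) => (uF n))) (Sum.elim (fun _ : Fin (3 + 1) => (1 : ℝ)) (fun _ : Fin (3 + 1) => (uF n))) ((Lc : ℝ) ^ 4 • dressV (Lc ^ (n + 1)) Lc (wStep Lc (n + 1)) (VN (Roots.ctr Lc) Pn n) μ y)) μ y))) (f a) (b.1, Sum.inl b.2) := by
  obtain ⟨m, hm⟩ := hf a
  have ha : f a = ((f a).1, Sum.inr m) := Prod.ext rfl hm
  have hsym : ∀ (x z : Site (3 + 1)) (α' m' : Fin (3 + 1)),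
      scaleK (Sum.elim (fun _ : Fin (3 + 1) => (1 : ℝ)) (fun _ : Fin (3 + 1) => (uF n))) (Sum.elim (fun _ : Fin (3 + 1) => (1 : ℝ)) (fun _ : Fin (3 + 1) => (uF n)))
          ((Lc : ℝ) ^ 4 • dressV (Lc ^ (n + 1)) Lc (wStep Lc (n + 1)) (VN (Roots.ctr Lc) Pn n) μ y) x z (Sum.inl α') (Sum.inr m')
        = scaleK (Sum.elim (fun _ : Fin (3 + 1) => (1 : ℝ)) (fun _ : Fin (3 + 1) => (uF n))) (Sum.elim (fun _ : Fin (3 + 1) => (1 : ℝ)) (fun _ : Fin (3 + 1) => (uF n)))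
          ((Lc : ℝ) ^ 4 • dressV (Lc ^ (n + 1)) Lc (wStep Lc (n + 1)) (VN (Roots.ctr Lc) Pn n) μ y) z x (Sum.inr m') (Sum.inl α') :=
    fun x z α' m' => FRec_inl_inr_eq_transpose Pn uF n μ y x z α' m'
  rw [ha, perF_apply, perF_apply]
  beta_reduce
  generalize scaleK (Sum.elim (fun _ : Fin (3 + 1) => (1 : ℝ)) (fun _ : Fin (3 + 1) => (uF n))) (Sum.elim (fun _ : Fin (3 + 1) => (1 : ℝ)) (fun _ : Fin (3 + 1) => (uF n)))
      ((Lc : ℝ) ^ 4 • dressV (Lc ^ (n + 1)) Lc (wStep Lc (n + 1)) (VN (Roots.ctr Lc) Pn n) μ y) = K at hsym ⊢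
  -- the symmetrised kernel: on the two blocks that matter it IS `K` (up to the transpose), and it is transpose-symmetric everywhere
  let S : MKer (3 + 1) (Fib 3) := fun x z a' b' =>
    match a', b' with
    | Sum.inl α', Sum.inr m₁ => K x z (Sum.inl α') (Sum.inr m₁)
    | Sum.inr m₁, Sum.inl α' => K z x (Sum.inl α') (Sum.inr m₁)
    | _, _ => 0
  have hS : ∀ (x z : Site (3 + 1)) (a' b' : Fib 3), S x z a' b' = S z x b' a' := by
    intro x z a' b'
    rcases a' with α' | m₁ <;> rcases b' with α'' | m₂ <;> rfl
  have e1 : perZ M (dper M K) ((b.1 : ↥(pbox M)) : Site (3 + 1)) (((f a).1 : ↥(pbox M)) : Site (3 + 1)) (Sum.inl b.2) (Sum.inr m)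
      = perZ M (dper M S) ((b.1 : ↥(pbox M)) : Site (3 + 1)) (((f a).1 : ↥(pbox M)) : Site (3 + 1)) (Sum.inl b.2) (Sum.inr m) := by
    simp only [perZ_apply, dper_apply]; rfl
  have e2 : perZ M (dper M K) (((f a).1 : ↥(pbox M)) : Site (3 + 1)) ((b.1 : ↥(pbox M)) : Site (3 + 1)) (Sum.inr m) (Sum.inl b.2)
      = perZ M (dper M S) (((f a).1 : ↥(pbox M)) : Site (3 + 1)) ((b.1 : ↥(pbox M)) : Site (3 + 1)) (Sum.inr m) (Sum.inl b.2) := by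
    simp only [perZ_apply, dper_apply, ← hsym]; rfl
  rw [e1, e2]
  exact perZ_dper_symm M hS _ _ _ _

end Record

end Summit.QuantumFields.BalabanUV.Beta.FP.TowerFFamilyParities

end
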